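import Summits.QuantumFields.YangMills.Theorems.UniversalDetectorBlindCutoff

/-!
# Route `UniversalDetector`, LINE «blind detector» (item stmt-QuantumFields-24148 `BlindDetector`, stub
# `BlindSeqExtraction`): the `Q2` template for BLIND limit kernels

Fleet lead `ym-spine-19353-p1` g26 (crux `BalabanLadder.NT`, LINE g11-1 of ym-idea-8).  Blind variant of the tree's
`UniversalDetectorLimitExtraction.tendsto_latticeDoubleSum_of_near_kernel` (ym-idea-8 g4): the limit kernel `K` is
only MEASURABLE, continuous on `Ω = {∀ i, zᵢ ≠ 0}` and bounded off balls, and the pair functions `Φ_k` approximate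
`K(s_k x' − s_k x)` only on the charged pairs whose difference lies in an orthant annulus (all coordinates `≥ η` in
size).  Conclusion unchanged: `s_k⁸ Σ w₁(s_k x) w₂(s_k x') Φ_k(x, x') → ∫∫ w₁(x) w₂(y) K(y − x)`.

Proof: for the hyperplane cutoffs `χ_n` (`UniversalDetectorBlindCutoff`) the pair (`χ_n Φ_k`, `χ_n K`) meets the
hypotheses of the tree's template (`χ_n K` is continuous everywhere), so the cut-off sums converge to the cut-off
integral; both cutoff defects are bounded by a constant times the Schwartz-weighted mass of `1 − χ_n`, on the lattice
(`tendsto_latticeSum_cutoffDefect`) and in the continuum, and that mass tends to `0` (`tendsto_integral_cutoffDefect`);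
`tendsto_of_forall_approx` concludes (positivity along a vanishing defect then passes to the limit by the tree's
`ge_of_tendsto_of_neg_le`).  Pure analysis; no summit, rung or crux statement is proved here. [folklore]
-/

set_option autoImplicit false

noncomputable section

namespace Summit.QuantumFields.YangMills.Cruxes.UniversalDetectorBlindExtraction

open MeasureTheory Filter Topology Finset
open Literature.MathematicalPhysics.QuantumLattice (siteToE siteToE_apply)
open Literature.Probability.LatticeModels (Site box mem_box)
open Summit.QuantumFields.YangMills.Cruxes.UniversalDetectorLimitExtraction (tendsto_latticeDoubleSum_of_near_kernel)

/-- Separation of slab supports: charged pairs are `2t₀` apart. [folklore] -/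
theorem two_t0_le_norm_sub_of_charged (w₁ w₂ : SchwartzMap (EuclideanSpace ℝ (Fin 4)) ℝ) {t₀ : ℝ}
    (h₁ : tsupport (w₁ : EuclideanSpace ℝ (Fin 4) → ℝ) ⊆ {y | t₀ ≤ -(y 0)})
    (h₂ : tsupport (w₂ : EuclideanSpace ℝ (Fin 4) → ℝ) ⊆ {y | t₀ ≤ y 0})
    (u v : EuclideanSpace ℝ (Fin 4)) (hu : w₁ u ≠ 0) (hv : w₂ v ≠ 0) : 2 * t₀ ≤ ‖v - u‖ := by
  have hu' := h₁ (subset_tsupport _ hu)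
  have hv' := h₂ (subset_tsupport _ hv)
  simp only [Set.mem_setOf_eq] at hu' hv'
  have h : |(v - u) 0| ≤ ‖v - u‖ := by
    simpa [Real.norm_eq_abs] using PiLp.norm_apply_le (v - u) 0
  rw [PiLp.sub_apply] at h
  have := le_abs_self (v 0 - u 0)
  linarith

/-- **The blind `Q2` template.**  See the module docstring. [folklore] -/
theorem tendsto_latticeDoubleSum_blind
    (w₁ w₂ : SchwartzMap (EuclideanSpace ℝ (Fin 4)) ℝ) (K : EuclideanSpace ℝ (Fin 4) → ℝ) (t₀ : ℝ)
    (ht₀ : 0 < t₀) (h₁ : tsupport (w₁ : EuclideanSpace ℝ (Fin 4) → ℝ) ⊆ {y | t₀ ≤ -(y 0)})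
    (h₂ : tsupport (w₂ : EuclideanSpace ℝ (Fin 4) → ℝ) ⊆ {y | t₀ ≤ y 0})
    (hKm : Measurable K) (hKc : ContinuousOn K {z | ∀ i : Fin 4, z i ≠ 0})
    (hKb : ∀ η : ℝ, 0 < η → ∃ C : ℝ, ∀ z, η ≤ ‖z‖ → |K z| ≤ C)
    (s : ℕ → ℝ) (hs : ∀ k, 0 < s k) (hs0 : Tendsto s atTop (𝓝 0))
    (L : ℕ → ℕ) (hL : Tendsto (fun k => s k * L k) atTop atTop)
    (Φ : ℕ → Site 4 → Site 4 → ℝ) (M : ℝ)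
    (hM : ∀ᶠ k in atTop, ∀ x ∈ box 4 (L k), ∀ x' ∈ box 4 (L k),
      w₁ (s k • siteToE x) ≠ 0 → w₂ (s k • siteToE x') ≠ 0 →
      |Φ k x x' - K (s k • siteToE x' - s k • siteToE x)| ≤ M)
    (hnear : ∀ η R ε : ℝ, 0 < η → 0 < R → 0 < ε → ∀ᶠ k in atTop, ∀ x ∈ box 4 (L k), ∀ x' ∈ box 4 (L k),
      ‖s k • siteToE x‖ ≤ R → ‖s k • siteToE x'‖ ≤ R →
      w₁ (s k • siteToE x) ≠ 0 → w₂ (s k • siteToE x') ≠ 0 →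
      (∀ i : Fin 4, η ≤ |(s k • siteToE x' - s k • siteToE x) i|) →
      |Φ k x x' - K (s k • siteToE x' - s k • siteToE x)| ≤ ε) :
    Tendsto (fun k => (s k ^ 4) ^ 2 * ∑ x ∈ box 4 (L k), ∑ x' ∈ box 4 (L k),
        w₁ (s k • siteToE x) * w₂ (s k • siteToE x') * Φ k x x') atTop
      (𝓝 (∫ x, ∫ y, w₁ x * w₂ y * K (y - x))) := by
  -- constants
  obtain ⟨CK, hCK⟩ := hKb (2 * t₀) (by positivity)
  set CK' : ℝ := max CK 0 with hCK'
  have hCK'0 : 0 ≤ CK' := le_max_right _ _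
  have hKch : ∀ u v : EuclideanSpace ℝ (Fin 4), w₁ u ≠ 0 → w₂ v ≠ 0 → |K (v - u)| ≤ CK' :=
    fun u v hu hv => (hCK _ (two_t0_le_norm_sub_of_charged w₁ w₂ h₁ h₂ u v hu hv)).trans (le_max_left _ _)
  set B : ℝ := max M 0 + CK' with hB
  have hB0 : 0 ≤ B := add_nonneg (le_max_right _ _) hCK'0
  have hΦB : ∀ᶠ k in atTop, ∀ x ∈ box 4 (L k), ∀ x' ∈ box 4 (L k),
      w₁ (s k • siteToE x) ≠ 0 → w₂ (s k • siteToE x') ≠ 0 → |Φ k x x'| ≤ B := by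
    filter_upwards [hM] with k hk x hx x' hx' hw₁ hw₂
    have h1 := hk x hx x' hx' hw₁ hw₂
    have h2 := hKch _ _ hw₁ hw₂
    calc |Φ k x x'| = |(Φ k x x' - K (s k • siteToE x' - s k • siteToE x)) + K (s k • siteToE x' - s k • siteToE x)| := by
          ring_nf
      _ ≤ |Φ k x x' - K (s k • siteToE x' - s k • siteToE x)| + |K (s k • siteToE x' - s k • siteToE x)| :=
          abs_add_le _ _
      _ ≤ max M 0 + CK' := add_le_add (h1.trans (le_max_left _ _)) h2
  -- the cutoffs
  have hηn : ∀ n : ℕ, (0 : ℝ) < 1 / ((n : ℝ) + 1) := fun n => by positivity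
  choose χ hχc hχ0 hχ1 hχone hχzero using fun n : ℕ => exists_cutoff (hηn n)
  -- the cut-off kernels meet the hypotheses of the tree's template
  have hKn_cont : ∀ n, Continuous fun z => χ n z * K z :=
    fun n => continuous_cutoff_mul K hKc (χ n) (hχc n) (hηn n) (hχzero n)
  have hKn_bd : ∀ n, ∀ η : ℝ, 0 < η → ∃ C : ℝ, ∀ z : EuclideanSpace ℝ (Fin 4), η ≤ ‖z‖ → |χ n z * K z| ≤ C := by
    intro n η hη
    obtain ⟨C, hC⟩ := hKb η hη
    refine ⟨max C 0, fun z hz => ?_⟩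
    rw [abs_mul, abs_of_nonneg (hχ0 n z)]
    exact (mul_le_of_le_one_left (abs_nonneg _) (hχ1 n z)).trans ((hC z hz).trans (le_max_left _ _))
  have hv : ∀ n, Tendsto (fun k => (s k ^ 4) ^ 2 * ∑ x ∈ box 4 (L k), ∑ x' ∈ box 4 (L k),
      w₁ (s k • siteToE x) * w₂ (s k • siteToE x') *
        (χ n (s k • siteToE x' - s k • siteToE x) * Φ k x x')) atTop
      (𝓝 (∫ x, ∫ y, w₁ x * w₂ y * (χ n (y - x) * K (y - x)))) := by
    intro n
    refine tendsto_latticeDoubleSum_of_near_kernel (0 : Fin 4) w₁ w₂ (fun z => χ n z * K z) t₀ ht₀ h₁ h₂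
      (hKn_cont n).continuousOn (hKn_bd n) s hs hs0 L hL
      (fun k x x' => χ n (s k • siteToE x' - s k • siteToE x) * Φ k x x') M ?_ ?_
    · filter_upwards [hM] with k hk x hx x' hx' hw₁ hw₂
      rw [← mul_sub, abs_mul, abs_of_nonneg (hχ0 n _)]
      exact (mul_le_of_le_one_left (abs_nonneg _) (hχ1 n _)).trans (hk x hx x' hx' hw₁ hw₂)
    · intro R ε hR hε
      filter_upwards [hnear (1 / ((n : ℝ) + 1)) R ε (hηn n) hR hε] with k hk x hx x' hx' hxR hx'R hw₁ hw₂
      rw [← mul_sub]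
      by_cases hΩ : ∀ i : Fin 4, 1 / ((n : ℝ) + 1) ≤ |(s k • siteToE x' - s k • siteToE x) i|
      · rw [abs_mul, abs_of_nonneg (hχ0 n _)]
        exact (mul_le_of_le_one_left (abs_nonneg _) (hχ1 n _)).trans (hk x hx x' hx' hxR hx'R hw₁ hw₂ hΩ)
      · push Not at hΩ
        obtain ⟨i, hi⟩ := hΩ
        rw [hχzero n _ i hi.le, zero_mul, abs_zero]
        exact hε.le
  -- the cutoff defects
  set J : ℕ → ℝ := fun n => ∫ z : EuclideanSpace ℝ (Fin 4) × EuclideanSpace ℝ (Fin 4),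
    |w₁ z.1| * |w₂ z.2| * (1 - χ n (z.2 - z.1)) ∂(volume.prod volume) with hJdef
  have hJ0 : ∀ n, 0 ≤ J n := fun n =>
    integral_nonneg fun z => mul_nonneg (mul_nonneg (abs_nonneg _) (abs_nonneg _)) (by linarith [hχ1 n (z.2 - z.1)])
  have hJ : Tendsto J atTop (𝓝 0) := by
    refine tendsto_integral_cutoffDefect w₁ w₂ χ hχc hχ0 hχ1 fun z hz => ?_
    have hev : ∀ i : Fin 4, ∀ᶠ n : ℕ in atTop, 2 * (1 / ((n : ℝ) + 1)) ≤ |z i| := by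
      intro i
      have hpos : 0 < |z i| := abs_pos.2 (hz i)
      have ht : Tendsto (fun n : ℕ => 2 * (1 / ((n : ℝ) + 1))) atTop (𝓝 (2 * 0)) :=
        tendsto_one_div_add_atTop_nhds_zero_nat.const_mul 2
      rw [mul_zero] at ht
      exact ht.eventually (eventually_le_nhds hpos)
    filter_upwards [eventually_all.2 hev] with n hn
    exact hχone n z hn
  have hU : ∀ n, Tendsto (fun k => (s k ^ 4) ^ 2 * ∑ x ∈ box 4 (L k), ∑ x' ∈ box 4 (L k),
      |w₁ (s k • siteToE x)| * |w₂ (s k • siteToE x')| * (1 - χ n (s k • siteToE x' - s k • siteToE x))) atTop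
      (𝓝 (J n)) :=
    fun n => tendsto_latticeSum_cutoffDefect w₁ w₂ (χ n) (hχc n) (hχ0 n) (hχ1 n) s hs hs0 L hL
  -- the continuum defect: `|I_n − I| ≤ CK' · J n`
  have hwc : Continuous fun z : EuclideanSpace ℝ (Fin 4) × EuclideanSpace ℝ (Fin 4) => w₁ z.1 * w₂ z.2 :=
    (w₁.continuous.comp continuous_fst).mul (w₂.continuous.comp continuous_snd)
  have hKmeas : Measurable fun z : EuclideanSpace ℝ (Fin 4) × EuclideanSpace ℝ (Fin 4) => K (z.2 - z.1) :=
    hKm.comp (measurable_snd.sub measurable_fst)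
  have hF := integrable_absWeight_prod w₁ w₂
  have hdomF : ∀ z : EuclideanSpace ℝ (Fin 4) × EuclideanSpace ℝ (Fin 4),
      |w₁ z.1 * w₂ z.2 * K (z.2 - z.1)| ≤ CK' * (|w₁ z.1| * |w₂ z.2|) := by
    intro z
    by_cases hu : w₁ z.1 = 0
    · rw [hu]; simp
    by_cases hv' : w₂ z.2 = 0
    · rw [hv']; simp
    rw [abs_mul, abs_mul]
    have h := hKch _ _ hu hv'
    calc |w₁ z.1| * |w₂ z.2| * |K (z.2 - z.1)| ≤ |w₁ z.1| * |w₂ z.2| * CK' :=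
          mul_le_mul_of_nonneg_left h (by positivity)
      _ = CK' * (|w₁ z.1| * |w₂ z.2|) := by ring
  have hintF : Integrable (fun z : EuclideanSpace ℝ (Fin 4) × EuclideanSpace ℝ (Fin 4) =>
      w₁ z.1 * w₂ z.2 * K (z.2 - z.1)) (volume.prod volume) := by
    refine (hF.const_mul CK').mono' ((hwc.measurable.mul hKmeas).aestronglyMeasurable)
      (Filter.Eventually.of_forall fun z => ?_)
    rw [Real.norm_eq_abs]; exact hdomF z
  have hintFn : ∀ n, Integrable (fun z : EuclideanSpace ℝ (Fin 4) × EuclideanSpace ℝ (Fin 4) =>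
      w₁ z.1 * w₂ z.2 * (χ n (z.2 - z.1) * K (z.2 - z.1))) (volume.prod volume) := by
    intro n
    refine (hF.const_mul CK').mono'
      ((hwc.mul ((hKn_cont n).comp (continuous_snd.sub continuous_fst))).aestronglyMeasurable)
      (Filter.Eventually.of_forall fun z => ?_)
    rw [Real.norm_eq_abs]
    have h1 : |w₁ z.1 * w₂ z.2 * (χ n (z.2 - z.1) * K (z.2 - z.1))| =
        χ n (z.2 - z.1) * |w₁ z.1 * w₂ z.2 * K (z.2 - z.1)| := by
      rw [show w₁ z.1 * w₂ z.2 * (χ n (z.2 - z.1) * K (z.2 - z.1)) =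
        χ n (z.2 - z.1) * (w₁ z.1 * w₂ z.2 * K (z.2 - z.1)) by ring, abs_mul, abs_of_nonneg (hχ0 n _)]
    rw [h1]
    exact (mul_le_of_le_one_left (abs_nonneg _) (hχ1 n _)).trans (hdomF z)
  have hI : ∫ x, ∫ y, w₁ x * w₂ y * K (y - x) =
      ∫ z : EuclideanSpace ℝ (Fin 4) × EuclideanSpace ℝ (Fin 4), w₁ z.1 * w₂ z.2 * K (z.2 - z.1)
        ∂(volume.prod volume) := (integral_prod _ hintF).symm
  have hIn : ∀ n, ∫ x, ∫ y, w₁ x * w₂ y * (χ n (y - x) * K (y - x)) =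
      ∫ z : EuclideanSpace ℝ (Fin 4) × EuclideanSpace ℝ (Fin 4),
        w₁ z.1 * w₂ z.2 * (χ n (z.2 - z.1) * K (z.2 - z.1)) ∂(volume.prod volume) :=
    fun n => (integral_prod _ (hintFn n)).symm
  have hint_def : ∀ n, Integrable (fun z : EuclideanSpace ℝ (Fin 4) × EuclideanSpace ℝ (Fin 4) =>
      CK' * (|w₁ z.1| * |w₂ z.2| * (1 - χ n (z.2 - z.1)))) (volume.prod volume) := by
    intro n
    refine (hF.const_mul CK').mono' ?_ (Filter.Eventually.of_forall fun z => ?_)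
    · exact (continuous_const.mul (((continuous_abs.comp (w₁.continuous.comp continuous_fst)).mul
        (continuous_abs.comp (w₂.continuous.comp continuous_snd))).mul
        (continuous_const.sub ((hχc n).comp (continuous_snd.sub continuous_fst))))).aestronglyMeasurable
    · have h0 : 0 ≤ 1 - χ n (z.2 - z.1) := by linarith [hχ1 n (z.2 - z.1)]
      have h1 : 1 - χ n (z.2 - z.1) ≤ 1 := by linarith [hχ0 n (z.2 - z.1)]
      have hw : 0 ≤ |w₁ z.1| * |w₂ z.2| := mul_nonneg (abs_nonneg _) (abs_nonneg _)
      rw [Real.norm_eq_abs, abs_of_nonneg (mul_nonneg hCK'0 (mul_nonneg hw h0))]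
      exact mul_le_mul_of_nonneg_left (mul_le_of_le_one_right hw h1) hCK'0
  have hcont_defect : ∀ n, |(∫ x, ∫ y, w₁ x * w₂ y * (χ n (y - x) * K (y - x))) -
      ∫ x, ∫ y, w₁ x * w₂ y * K (y - x)| ≤ CK' * J n := by
    intro n
    rw [hI, hIn, ← integral_sub (hintFn n) hintF]
    refine (abs_integral_le_integral_abs).trans ?_
    rw [hJdef]
    simp only
    rw [← integral_const_mul]
    refine integral_mono_of_nonneg (Filter.Eventually.of_forall fun z => abs_nonneg _) (hint_def n)
      (Filter.Eventually.of_forall fun z => ?_)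
    · dsimp only
      have e : w₁ z.1 * w₂ z.2 * (χ n (z.2 - z.1) * K (z.2 - z.1)) - w₁ z.1 * w₂ z.2 * K (z.2 - z.1) =
          -((1 - χ n (z.2 - z.1)) * (w₁ z.1 * w₂ z.2 * K (z.2 - z.1))) := by ring
      rw [e, abs_neg, abs_mul, abs_of_nonneg (by linarith [hχ1 n (z.2 - z.1)])]
      calc (1 - χ n (z.2 - z.1)) * |w₁ z.1 * w₂ z.2 * K (z.2 - z.1)|
          ≤ (1 - χ n (z.2 - z.1)) * (CK' * (|w₁ z.1| * |w₂ z.2|)) :=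
            mul_le_mul_of_nonneg_left (hdomF z) (by linarith [hχ1 n (z.2 - z.1)])
        _ = CK' * (|w₁ z.1| * |w₂ z.2| * (1 - χ n (z.2 - z.1))) := by ring
  -- the lattice defect: eventually `|u k − v_n k| ≤ B · U_n k`
  have hlat_defect : ∀ n, ∀ᶠ k in atTop,
      |(s k ^ 4) ^ 2 * ∑ x ∈ box 4 (L k), ∑ x' ∈ box 4 (L k),
          w₁ (s k • siteToE x) * w₂ (s k • siteToE x') * Φ k x x' -
        (s k ^ 4) ^ 2 * ∑ x ∈ box 4 (L k), ∑ x' ∈ box 4 (L k),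
          w₁ (s k • siteToE x) * w₂ (s k • siteToE x') *
            (χ n (s k • siteToE x' - s k • siteToE x) * Φ k x x')| ≤
      B * ((s k ^ 4) ^ 2 * ∑ x ∈ box 4 (L k), ∑ x' ∈ box 4 (L k),
          |w₁ (s k • siteToE x)| * |w₂ (s k • siteToE x')| * (1 - χ n (s k • siteToE x' - s k • siteToE x))) := by
    intro n
    filter_upwards [hΦB] with k hk
    rw [← mul_sub, ← sum_sub_distrib, abs_mul, abs_of_nonneg (by positivity : (0 : ℝ) ≤ (s k ^ 4) ^ 2),
      mul_left_comm]
    refine mul_le_mul_of_nonneg_left ?_ (by positivity)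
    rw [mul_sum]
    refine (abs_sum_le_sum_abs _ _).trans (sum_le_sum fun x hx => ?_)
    rw [← sum_sub_distrib, mul_sum]
    refine (abs_sum_le_sum_abs _ _).trans (sum_le_sum fun x' hx' => ?_)
    have h01 : 0 ≤ 1 - χ n (s k • siteToE x' - s k • siteToE x) := by linarith [hχ1 n (s k • siteToE x' - s k • siteToE x)]
    by_cases hw₁ : w₁ (s k • siteToE x) = 0
    · rw [hw₁]; simp
    by_cases hw₂ : w₂ (s k • siteToE x') = 0
    · rw [hw₂]; simp
    have hb := hk x hx x' hx' hw₁ hw₂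
    have e : w₁ (s k • siteToE x) * w₂ (s k • siteToE x') * Φ k x x' -
        w₁ (s k • siteToE x) * w₂ (s k • siteToE x') * (χ n (s k • siteToE x' - s k • siteToE x) * Φ k x x') =
        (w₁ (s k • siteToE x) * w₂ (s k • siteToE x')) * (1 - χ n (s k • siteToE x' - s k • siteToE x)) *
          Φ k x x' := by ring
    rw [e, abs_mul, abs_mul, abs_mul, abs_of_nonneg h01]
    calc |w₁ (s k • siteToE x)| * |w₂ (s k • siteToE x')| * (1 - χ n (s k • siteToE x' - s k • siteToE x)) *
          |Φ k x x'| ≤ |w₁ (s k • siteToE x)| * |w₂ (s k • siteToE x')| *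
          (1 - χ n (s k • siteToE x' - s k • siteToE x)) * B := mul_le_mul_of_nonneg_left hb (by positivity)
      _ = B * (|w₁ (s k • siteToE x)| * |w₂ (s k • siteToE x')| *
          (1 - χ n (s k • siteToE x' - s k • siteToE x))) := by ring
  -- conclusion by approximate limits
  refine tendsto_of_forall_approx _ _ fun δ hδ => ?_
  have hT : Tendsto (fun n : ℕ => (B + CK' + 1) * (J n + 1 / ((n : ℝ) + 1))) atTop (𝓝 ((B + CK' + 1) * (0 + 0))) :=
    (hJ.add tendsto_one_div_add_atTop_nhds_zero_nat).const_mul _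
  rw [add_zero, mul_zero] at hT
  obtain ⟨n, hn⟩ := (hT.eventually (eventually_lt_nhds hδ)).exists
  have hn1 : 0 < 1 / ((n : ℝ) + 1) := hηn n
  refine ⟨_, _, hv n, ?_, ?_⟩
  · refine (hcont_defect n).trans ?_
    have : CK' * J n ≤ (B + CK' + 1) * (J n + 1 / ((n : ℝ) + 1)) := by nlinarith [hJ0 n]
    linarith
  · have hUev : ∀ᶠ k in atTop, (s k ^ 4) ^ 2 * ∑ x ∈ box 4 (L k), ∑ x' ∈ box 4 (L k),
        |w₁ (s k • siteToE x)| * |w₂ (s k • siteToE x')| * (1 - χ n (s k • siteToE x' - s k • siteToE x)) ≤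
        J n + 1 / ((n : ℝ) + 1) := by
      have := (Metric.tendsto_nhds.mp (hU n)) (1 / ((n : ℝ) + 1)) hn1
      filter_upwards [this] with k hk
      rw [Real.dist_eq] at hk
      have := (abs_lt.1 hk).2; linarith
    filter_upwards [hlat_defect n, hUev] with k hk hk'
    refine hk.trans ?_
    have : B * (J n + 1 / ((n : ℝ) + 1)) ≤ (B + CK' + 1) * (J n + 1 / ((n : ℝ) + 1)) := by nlinarith [hJ0 n]
    nlinarith [hJ0 n]

end Summit.QuantumFields.YangMills.Cruxes.UniversalDetectorBlindExtraction

end
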